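import Literature.NumberTheory.Irrationality.Fischler2002.RhinViolaGroup32Proofs
import HarnessLib

/-!
# Fischler 2002, Théorème 3.2 — brick I: `σ, ψ, φ` restrict to involutive permutations of `𝓔`

Topic `Literature/NumberTheory/Irrationality/Fischler2002`. PROOFS ONLY (no definition, no statement, no discharge): a first
brick toward the named fact `theoreme32` of `RhinViolaGroupsGeneral.lean`,

> [Fischler2002Polyzetas, §3 Théorème 3.2] « La famille des `𝒥(p)`, pour `p ∈ 𝓔`, admet un groupe de Rhin-Viola `G` engendré
> par `σ`, `ψ` et `φ`. Plus précisément : pour `n ≥ 4`, ce groupe est isomorphe à `(𝔖₃ × 𝔖₃) ⋊ ℤ/2ℤ`, donc d'ordre 72 … Pour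
> `n = 3`, le groupe `G` est isomorphe à `H ⋊ 𝔖₅` … Pour `n = 2`, le groupe `G` est isomorphe à `𝔖₅` » (read on the page,
> `paper:arxiv-math_0202064` p. 4; journal [Fischler2003RhinViola, §3.3 Th. 5, §3.4 Th. 6]),

whose typed form asks first for permutations `σ', ψ', φ'` of the subtype `{p : Exponents // InE n p}` with underlying maps
`sigma`, `psi n`, `phi n`. This file proves exactly that part, for every `n ≥ 2`: the three maps PRESERVE `𝓔`
(`InE_sigma_iff`, `InE_psi_iff`, `InE_phi_iff` — index algebra on the printed relations `c₂ = ⋯ = c_{n−1} = 0`,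
`a₁ + b₂ = a₃ + b₃` (`n = 3`), `a₂ = b₁`, `b_n = c_n`, `a_k + b_{k+1} = a_{k+2} + b_{k+2}` (`n ≥ 4`)), `φ` is an INVOLUTION
(`phi_phi`; `sigma_sigma` is in the statement file, `Prop31.psi_psi` in P1 g44's file), hence `exists_perms`; and, for later
bricks, the relations `σ'² = ψ'² = φ'² = 1` and `σ'φ' = φ'σ'` (`n ≥ 4`, disjoint coordinates) for ANY permutations with these
underlying maps. Cell `pub-zeta5`, seat ct-1 g33, 2026-08-27; the group orders `120 / 1920 / 72` and the Rhin–Viola clause are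
NOT touched here (reconnaissance: `HOME/ct-1/g33/THEOREME32-RECON.md`).

HONEST FRAMING (cell pub-zeta5): systematic search; no irrationality claim unless certified — pure bookkeeping of printed
maps on integer parameters; nothing about `ζ(5)`.
-/

namespace Literature.NumberTheory.Irrationality.Fischler2002

namespace Theoreme32

/-! ### `φ` is an involution -/

/-- `φ` is an involution of `ℤ^{3n−1}` (on the typed record `Exponents`), for every `n ≥ 2`.
[cite: Fischler2002Polyzetas, §3 p. 4 (φ « automorphisme de 𝓔 »)] -/
theorem phi_phi {n : ℕ} (hn : 2 ≤ n) (p : Exponents) : phi n (phi n p) = p := by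
  cases p with
  | mk a b c =>
  simp only [phi, Exponents.mk.injEq]
  refine ⟨?_, ?_, ?_⟩
  · funext k
    split_ifs <;> grind
  · funext k
    split_ifs <;> grind
  · funext k
    split_ifs <;> grind

/-! ### `σ, ψ, φ` preserve `𝓔` -/

/-- `σ(𝓔) ⊆ 𝓔`: `σ` fixes the `c`'s, preserves `a₁ + b₂` and the relation `a₂ = b₁`, and the chain relation at `k = 2` uses
`a₂ = b₁`. [cite: Fischler2002Polyzetas, §3 p. 4 (σ, ψ « conservent » 𝓔)] -/
theorem InE_sigma {n : ℕ} {p : Exponents} (h : InE n p) : InE n (sigma p) := by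
  obtain ⟨hc, h3, h4⟩ := h
  refine ⟨fun k hk2 hkn => ?_, fun h3n => ?_, fun h4n => ?_⟩
  · simp only [sigma]
    exact hc k hk2 hkn
  · have e := h3 h3n
    simp only [sigma]
    split_ifs <;> grind
  · obtain ⟨h21, hbn, hch⟩ := h4 h4n
    refine ⟨?_, ?_, fun k hk1 hkn => ?_⟩
    · simp only [sigma]
      split_ifs <;> grind
    · simp only [sigma]
      split_ifs <;> grind
    · have e := hch k hk1 hkn
      have e1 := hch 1 le_rfl (by omega)
      simp only [sigma]
      split_ifs <;> grind

/-- `ψ(𝓔) ⊆ 𝓔` (`n ≥ 2`): the `c'_k = a_{n+2−k} + b_{n+2−k} + c_{n+1−k} − b_{n+1−k} − a_{n−k}` vanish on `𝓔` by the chain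
relations, `a'₂ = a_{n−1} = b'₁` by `b_n = c_n`, `b'_n = b₂ = c'_n` by `a₂ = b₁`, and the chain is reversed.
[cite: Fischler2002Polyzetas, §3 p. 4 (σ, ψ « conservent » 𝓔)] -/
theorem InE_psi {n : ℕ} (hn : 2 ≤ n) {p : Exponents} (h : InE n p) : InE n (psi n p) := by
  obtain ⟨hc, h3, h4⟩ := h
  refine ⟨fun k hk2 hkn => ?_, fun h3n => ?_, fun h4n => ?_⟩
  · -- `c'_k = 0` for `2 ≤ k ≤ n−1`
    have hc' := hc (n + 1 - k) (by omega) (by omega)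
    rcases Nat.lt_or_ge n 4 with hn4 | hn4
    · -- then `n = 3`, `k = 2`
      have hn3 : n = 3 := by omega
      subst hn3
      have hk : k = 2 := by omega
      subst hk
      have e := h3 rfl
      simp only [show 3 + 1 - 2 = 2 from rfl] at hc'
      simp only [psi, show 3 + 2 - 2 = 3 from rfl, show 3 + 1 - 2 = 2 from rfl, show 3 - 2 = 1 from rfl]
      split_ifs <;> grind
    · obtain ⟨-, -, hch⟩ := h4 hn4
      have e := hch (n - k) (by omega) (by omega)
      rw [show n - k + 1 = n + 1 - k by omega, show n - k + 2 = n + 2 - k by omega] at e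
      simp only [psi]
      split_ifs <;> grind
  · -- `n = 3`: `a'₁ + b'₂ = a'₃ + b'₃`
    subst h3n
    have e := h3 rfl
    simp only [psi, show 3 + 1 - 1 = 3 from rfl, show 3 + 1 - 3 = 1 from rfl, show 3 + 2 - 3 = 2 from rfl]
    split_ifs <;> grind
  · obtain ⟨h21, hbn, hch⟩ := h4 h4n
    refine ⟨?_, ?_, fun k hk1 hkn => ?_⟩
    · -- `a'₂ = b'₁`
      simp only [psi, show n + 1 - 2 = n - 1 by omega]
      split_ifs <;> grind
    · -- `b'_n = c'_n`
      simp only [psi, show n + 2 - n = 2 by omega]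
      split_ifs <;> grind
    · -- the chain, reversed
      have e := hch (n - 1 - k) (by omega) (by omega)
      rw [show n - 1 - k + 1 = n - k by omega, show n - 1 - k + 2 = n + 1 - k by omega] at e
      simp only [psi, show n + 2 - (k + 1) = n + 1 - k by omega, show n + 1 - (k + 2) = n - 1 - k by omega,
        show n + 2 - (k + 2) = n - k by omega]
      split_ifs <;> grind

/-- `φ(𝓔) ⊆ 𝓔` (`n ≥ 2`): `φ` moves only `a_{n−1}, b_{n−1}, b_n, c_n`; `b'_n − c'_n = b_n − c_n`, and the two chain relations
through `b_{n−1}, b_n` are preserved. [cite: Fischler2002Polyzetas, §3 p. 4 (φ « automorphisme de 𝓔 »)] -/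
theorem InE_phi {n : ℕ} (hn : 2 ≤ n) {p : Exponents} (h : InE n p) : InE n (phi n p) := by
  obtain ⟨hc, h3, h4⟩ := h
  refine ⟨fun k hk2 hkn => ?_, fun h3n => ?_, fun h4n => ?_⟩
  · have e := hc k hk2 hkn
    simp only [phi]
    split_ifs <;> grind
  · subst h3n
    have e := h3 rfl
    simp only [phi, show (3 : ℕ) - 1 = 2 from rfl]
    split_ifs <;> grind
  · obtain ⟨h21, hbn, hch⟩ := h4 h4n
    refine ⟨?_, ?_, fun k hk1 hkn => ?_⟩
    · simp only [phi]
      split_ifs <;> grind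
    · simp only [phi]
      split_ifs <;> grind
    · have e := hch k hk1 hkn
      by_cases hk2 : k = n - 2
      · subst hk2
        rw [show n - 2 + 1 = n - 1 by omega, show n - 2 + 2 = n by omega] at e
        simp only [phi, show n - 2 + 1 = n - 1 by omega, show n - 2 + 2 = n by omega]
        split_ifs <;> grind
      · by_cases hk3 : k = n - 3
        · subst hk3
          rw [show n - 3 + 1 = n - 2 by omega, show n - 3 + 2 = n - 1 by omega] at e
          simp only [phi, show n - 3 + 1 = n - 2 by omega, show n - 3 + 2 = n - 1 by omega]
          split_ifs <;> grind
        · simp only [phi]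
          split_ifs <;> grind

/-- `σp ∈ 𝓔 ↔ p ∈ 𝓔`. [cite: Fischler2002Polyzetas, §3 p. 4 (σ, ψ « conservent » 𝓔)] -/
theorem InE_sigma_iff {n : ℕ} (p : Exponents) : InE n (sigma p) ↔ InE n p :=
  ⟨fun h => by simpa [sigma_sigma] using InE_sigma h, InE_sigma⟩

/-- `ψp ∈ 𝓔 ↔ p ∈ 𝓔` (`n ≥ 2`). [cite: Fischler2002Polyzetas, §3 p. 4 (σ, ψ « conservent » 𝓔)] -/
theorem InE_psi_iff {n : ℕ} (hn : 2 ≤ n) (p : Exponents) : InE n (psi n p) ↔ InE n p :=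
  ⟨fun h => by simpa [Prop31.psi_psi hn] using InE_psi hn h, InE_psi hn⟩

/-- `φp ∈ 𝓔 ↔ p ∈ 𝓔` (`n ≥ 2`). [cite: Fischler2002Polyzetas, §3 p. 4 (φ « automorphisme de 𝓔 »)] -/
theorem InE_phi_iff {n : ℕ} (hn : 2 ≤ n) (p : Exponents) : InE n (phi n p) ↔ InE n p :=
  ⟨fun h => by simpa [phi_phi hn] using InE_phi hn h, InE_phi hn⟩

/-! ### The restricted permutations `σ', ψ', φ'` -/

/-- **`σ, ψ, φ` restrict to permutations of `𝓔`** (`n ≥ 2`): there are `σ', ψ', φ' ∈ Perm {p // p ∈ 𝓔}` with underlying maps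
`sigma`, `psi n`, `phi n` — the first clause of the typed `theoreme32`. [cite: Fischler2002Polyzetas, §3 Théorème 3.2] -/
theorem exists_perms {n : ℕ} (hn : 2 ≤ n) :
    ∃ σ' ψ' φ' : Equiv.Perm {p : Exponents // InE n p},
      (∀ p, (σ' p).1 = sigma p.1) ∧ (∀ p, (ψ' p).1 = psi n p.1) ∧ (∀ p, (φ' p).1 = phi n p.1) :=
  ⟨(Function.Involutive.toPerm sigma sigma_sigma).subtypePerm InE_sigma_iff,
    (Function.Involutive.toPerm (psi n) (Prop31.psi_psi hn)).subtypePerm (InE_psi_iff hn),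
    (Function.Involutive.toPerm (phi n) (phi_phi hn)).subtypePerm (InE_phi_iff hn),
    fun _ => rfl, fun _ => rfl, fun _ => rfl⟩

/-! ### Relations for ANY permutations with these underlying maps -/

section Relations

variable {n : ℕ} {gσ gψ gφ : Equiv.Perm {p : Exponents // InE n p}}

/-- `σ'² = 1`. [cite: Fischler2002Polyzetas, §3 Théorème 3.2] -/
theorem perm_sigma_mul_self (hσ : ∀ p, (gσ p).1 = sigma p.1) : gσ * gσ = 1 :=
  Equiv.ext fun p => Subtype.ext (by rw [Equiv.Perm.mul_apply, hσ, hσ, sigma_sigma]; rfl)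

/-- `ψ'² = 1` (`n ≥ 2`). [cite: Fischler2002Polyzetas, §3 Théorème 3.2] -/
theorem perm_psi_mul_self (hn : 2 ≤ n) (hψ : ∀ p, (gψ p).1 = psi n p.1) : gψ * gψ = 1 :=
  Equiv.ext fun p => Subtype.ext (by rw [Equiv.Perm.mul_apply, hψ, hψ, Prop31.psi_psi hn]; rfl)

/-- `φ'² = 1` (`n ≥ 2`). [cite: Fischler2002Polyzetas, §3 Théorème 3.2] -/
theorem perm_phi_mul_self (hn : 2 ≤ n) (hφ : ∀ p, (gφ p).1 = phi n p.1) : gφ * gφ = 1 :=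
  Equiv.ext fun p => Subtype.ext (by rw [Equiv.Perm.mul_apply, hφ, hφ, phi_phi hn]; rfl)

/-- `σ` and `φ` commute for `n ≥ 4` (disjoint coordinates: `σ` moves `a₁, a₂, b₁, b₂`, `φ` moves `a_{n−1}, b_{n−1}, b_n, c_n`).
[cite: Fischler2002Polyzetas, §3 Théorème 3.2] -/
theorem sigma_phi_comm (hn : 4 ≤ n) (p : Exponents) : sigma (phi n p) = phi n (sigma p) := by
  cases p with
  | mk a b c =>
  simp only [phi, sigma, Exponents.mk.injEq]
  refine ⟨?_, ?_, ?_⟩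
  · funext k
    split_ifs <;> grind
  · funext k
    split_ifs <;> grind
  · funext k
    split_ifs <;> grind

/-- `σ'φ' = φ'σ'` for `n ≥ 4`. [cite: Fischler2002Polyzetas, §3 Théorème 3.2] -/
theorem perm_sigma_phi (hn : 4 ≤ n) (hσ : ∀ p, (gσ p).1 = sigma p.1) (hφ : ∀ p, (gφ p).1 = phi n p.1) :
    gσ * gφ = gφ * gσ :=
  Equiv.ext fun p => Subtype.ext (by rw [Equiv.Perm.mul_apply, Equiv.Perm.mul_apply, hσ, hφ, hφ, hσ, sigma_phi_comm hn])

end Relations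

end Theoreme32

end Literature.NumberTheory.Irrationality.Fischler2002
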